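/- Lead `ym-line-cbag-p1` (seat prover-ym-line-cbag-p1-g0-0, stub-worker), route `ColdBoxAllGroups`, crux `BoxFloorAllGroups`
(stmt-QuantumFields-22254), line `birth` (skeleton v4): registered stub S3 `stub_boxGaussianDominationG_of_abs`. -/
import Summits.QuantumFields.YangMills.Theorems.WeakCouplingRatesColdBoxStubOfAbs
import Summits.QuantumFields.YangMills.Theorems.EquipartitionCriticalityFreeEnergyLogCoefficientDefs
import Summits.QuantumFields.YangMills.Theorems.WeakCouplingRates

/-!
# Crux `BoxFloorAllGroups` (stmt-QuantumFields-22254), line `birth`, stub S3 `stub_boxGaussianDominationG_of_abs`: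
# the ABSOLUTE Dirichlet comparison implies the RELATIVE free form, for every compact simple `G`

The all-groups port of the proved `SU(2)` reduction `WeakCouplingRates.stub_boxGaussianDomination_of_abs`
(`Theorems/WeakCouplingRatesColdBoxStubOfAbs.lean`), with the Gaussian constant `¾ ↦ D/4` (`D = dimE r.ρ`, the real dimension
of the Lie algebra of `r(G) ≤ U(N)`) and the error band `½Π² ↦ ⅛·boxCircSqCov = ¼Π²` (`Π = boxMaxwellPlaqCov`, Wick
`stub_boxGaussianWick : boxCircSqCov = 2Π²`).

* Hypothesis (the conclusion of the load-bearing stub S2 `stub_boxDirichletDominationAbsG`, universal in `G`): for every compact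
  simple `G` and lattice representation `r` there is `θ₀ > 0` such that for `0 < θ ≤ θ₀` some `κ > 8θ` satisfies, eventually in
  `β`, `|β²·boxPlaqCov r.ρ β H T − (D/4)·boxDirCircSqCov H T| ≤ β^{−κ}` for all `T ≤ H = ⌈β^θ⌉`.
* Conclusion (registered signature, verbatim): for the same `θ₀`, all `0 < A < θ ≤ θ₀`, eventually in `β`, at `T = ⌈β^A⌉`,
  `|β²·boxPlaqCov − (D/4)·boxCircSqCov| ≤ (1/8)·boxCircSqCov`.

The group enters only through the hypothesis: the reduction is proved for an arbitrary function `F β H T` in place of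
`β²·boxPlaqCov r.ρ β H T` and an arbitrary weight `0 ≤ D` (`gaussianDomination_of_abs_dim`).  The one change w.r.t. the `SU(2)`
template is that the kernel precision must scale with `D`: with `M = 1 + 80π²(K₁+K₂)(D+1)` and `H ≥ 8MT` the two kernel
comparisons `exists_boxMaxwellPlaqCov_sub_bound`, `exists_boxDirichletPlaqCov_sub_bound` (`|Π − C(T)|, |Π_D − C(T)| ≤ K/H⁴`)
give `|Π − C|, |Π_D − C| ≤ C/(40(D+1))` (`C = C(T) ≥ T⁻⁴/(2π²)` by `exists_curvaturePlaquetteCorr_asymp`), while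
`β^{−κ} ≤ C²/20` eventually (`rpow_neg_mul_pow_le_eventually`, `κ > 8θ > 8A`, `T ≤ 2β^A`).  The scalar endgame
`scalar_relative_of_abs_dim` (`(D/2)|Π_D² − Π²| ≤ 0.052C²`, `|e| ≤ 0.05C²`, `¼Π² ≥ 0.237C²`) closes the `¼Π²` band after the two
Wick identities `stub_boxGaussianWick`, `boxDirCircSqCov_eq_two_mul_sq`.

Everything proved; no definition; no sorry; standard axioms.  NOT a claim about the Yang–Mills mass gap (rung-level support).
-/

set_option autoImplicit false

open Real MeasureTheory
open Literature.MathematicalPhysics.QuantumLattice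
open Literature.MathematicalPhysics.QuantumFieldTheory
open Summit.QuantumFields.YangMills.Theorems.WeakCouplingRates
open Summit.QuantumFields.YangMills.Theorems.FreeEnergyLogCoefficient

namespace Summit.QuantumFields.YangMills.Theorems.ColdBoxAllGroups

/-- **Scalar endgame, precision scaled by the weight `D ≥ 0`.**  If `a, b` are within `C/(40(D+1))` of `C ≥ 0` and
`|e| ≤ C²/20`, then `|(D/4)·2b² + e − (D/4)·2a²| ≤ (1/8)·2a²`: with `δ = C/(40(D+1))` one has `δ ≤ C/40`, `Dδ ≤ C/40`, hence
`D|b² − a²| ≤ 2Dδ(a + b) ≤ (C/20)(41C/20)`, while `a ≥ 39C/40` gives `¼a² ≥ 0.237C² ≥ 41C²/800 + C²/20`. -/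
theorem scalar_relative_of_abs_dim {D a b C e : ℝ} (hD : 0 ≤ D) (hC : 0 ≤ C)
    (ha : |a - C| ≤ C / (40 * (D + 1))) (hb : |b - C| ≤ C / (40 * (D + 1))) (he : |e| ≤ C ^ 2 / 20) :
    |D / 4 * (2 * b ^ 2) + e - D / 4 * (2 * a ^ 2)| ≤ 1 / 8 * (2 * a ^ 2) := by
  have hD1 : 0 < D + 1 := by linarith
  -- the precision `δ = C/(40(D+1))`: `δ ≤ C/40` and `D·δ ≤ C/40`
  set δ : ℝ := C / (40 * (D + 1)) with hδ
  have hδC : δ ≤ C / 40 := by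
    rw [hδ, div_le_div_iff₀ (by positivity) (by norm_num)]
    nlinarith
  have hDδ : D * δ ≤ C / 40 := by
    rw [hδ, ← mul_div_assoc, div_le_div_iff₀ (by positivity) (by norm_num)]
    nlinarith
  rw [abs_le] at ha hb he ⊢
  obtain ⟨ha1, ha2⟩ := ha
  obtain ⟨hb1, hb2⟩ := hb
  obtain ⟨he1, he2⟩ := he
  have hs0 : 0 ≤ b + a := by linarith
  have hs1 : b + a ≤ 41 / 20 * C := by linarith
  have hDs : 0 ≤ D * (b + a) := mul_nonneg hD hs0
  -- `2·Dδ·(a + b) ≤ 41C²/400`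
  have hDs1 : 2 * (D * δ) * (b + a) ≤ 41 / 400 * C ^ 2 := by
    have h1 : D * δ * (b + a) ≤ C / 40 * (b + a) := mul_le_mul_of_nonneg_right hDδ hs0
    have h2 : C / 40 * (b + a) ≤ C / 40 * (41 / 20 * C) := mul_le_mul_of_nonneg_left hs1 (by positivity)
    linarith
  -- `D·|b² − a²| ≤ 41C²/400`
  have hkey1 : D * (b ^ 2 - a ^ 2) ≤ 41 / 400 * C ^ 2 := by
    have h := mul_le_mul_of_nonneg_left (show b - a ≤ 2 * δ by linarith) hDs
    linarith
  have hkey2 : D * (a ^ 2 - b ^ 2) ≤ 41 / 400 * C ^ 2 := by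
    have h := mul_le_mul_of_nonneg_left (show a - b ≤ 2 * δ by linarith) hDs
    linarith
  -- `a ≥ 39C/40`
  have ha0 : 39 / 40 * C ≤ a := by linarith
  have halow : (39 / 40 * C) ^ 2 ≤ a ^ 2 := pow_le_pow_left₀ (by positivity) ha0 2
  constructor <;> linarith

/-- **The `D`-weighted reduction, generic form.**  For any function `F β H T` (standing for `β²·boxPlaqCov r.ρ β H T`) and any
weight `0 ≤ D`: the ABSOLUTE comparison with the Dirichlet surrogate — `∃ θ₀ > 0, ∀ 0 < θ ≤ θ₀, ∃ κ > 8θ, ∃ β₀, ∀ β ≥ β₀, ∀ T ≤ ⌈β^θ⌉,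
|F β ⌈β^θ⌉ T − (D/4)·boxDirCircSqCov ⌈β^θ⌉ T| ≤ β^{−κ}` — implies the RELATIVE comparison with the free surrogate at `T = ⌈β^A⌉`,
`0 < A < θ ≤ θ₀` (same `θ₀`): eventually `|F β ⌈β^θ⌉ ⌈β^A⌉ − (D/4)·boxCircSqCov| ≤ (1/8)·boxCircSqCov`.  Port of
`WeakCouplingRates.stub_boxGaussianDomination_of_abs` with the threshold `M = 1 + 80π²(K₁+K₂)(D+1)`. -/
theorem gaussianDomination_of_abs_dim (F : ℝ → ℕ → ℕ → ℝ) {D : ℝ} (hD : 0 ≤ D)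
    (habs : ∃ θ₀ : ℝ, 0 < θ₀ ∧ ∀ θ : ℝ, 0 < θ → θ ≤ θ₀ → ∃ κ : ℝ, 8 * θ < κ ∧ ∃ β₀ : ℝ, ∀ β : ℝ, β₀ ≤ β →
      ∀ T : ℕ, T ≤ ⌈β ^ θ⌉₊ → |F β ⌈β ^ θ⌉₊ T - D / 4 * boxDirCircSqCov ⌈β ^ θ⌉₊ T| ≤ β ^ (-κ)) :
    ∃ θ₀ : ℝ, 0 < θ₀ ∧ ∀ A θ : ℝ, 0 < A → A < θ → θ ≤ θ₀ → ∃ β₀ : ℝ, ∀ β : ℝ, β₀ ≤ β →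
      |F β ⌈β ^ θ⌉₊ ⌈β ^ A⌉₊ - D / 4 * boxCircSqCov ⌈β ^ θ⌉₊ ⌈β ^ A⌉₊| ≤ 1 / 8 * boxCircSqCov ⌈β ^ θ⌉₊ ⌈β ^ A⌉₊ := by
  obtain ⟨θ₀, hθ₀, habs⟩ := habs
  refine ⟨θ₀, hθ₀, fun A θ hA hAθ hθle => ?_⟩
  have hθ : 0 < θ := hA.trans hAθ
  obtain ⟨κ, hκ, β₁, h₁⟩ := habs θ hθ hθle
  obtain ⟨K₁, hK10, hE1⟩ := exists_boxMaxwellPlaqCov_sub_bound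
  obtain ⟨K₂, hK20, hE2⟩ := exists_boxDirichletPlaqCov_sub_bound
  obtain ⟨K_C, hKC0, hC⟩ := exists_curvaturePlaquetteCorr_asymp
  have hθA : 0 < θ - A := by linarith
  have hD1 : 0 < D + 1 := by linarith
  -- constants: kernel errors ≤ C/(40(D+1)), asymptotic error ≤ C₀/2, absolute error ≤ C²/20
  set M : ℝ := 1 + 80 * π ^ 2 * (K₁ + K₂) * (D + 1) with hM
  have hM0 : 0 ≤ 80 * π ^ 2 * (K₁ + K₂) * (D + 1) := by positivity
  have hM1 : 1 ≤ M := by linarith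
  set L : ℝ := 2 * π ^ 2 * K_C + 1 with hL
  have hL0 : 0 ≤ 2 * π ^ 2 * K_C := by positivity
  have hL1 : 1 ≤ L := by linarith
  obtain ⟨β₄, -, h₄⟩ := rpow_neg_mul_pow_le_eventually (A := A) (κ := κ) (by linarith)
    (by positivity : (0 : ℝ) < 1 / (4 * π ^ 4) / 20)
  set β₀ : ℝ := max (max (max 1 ((32 : ℝ) ^ (1 / θ))) (max ((16 * M) ^ (1 / (θ - A))) (L ^ (1 / A)))) (max β₁ β₄)
  refine ⟨β₀, fun β hβ => ?_⟩
  have hβa : max (max 1 ((32 : ℝ) ^ (1 / θ))) (max ((16 * M) ^ (1 / (θ - A))) (L ^ (1 / A))) ≤ β :=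
    (le_max_left _ _).trans hβ
  have hb₁ : β₁ ≤ β := le_trans (le_trans (le_max_left _ _) (le_max_right _ _)) hβ
  have hb₄ : β₄ ≤ β := le_trans (le_trans (le_max_right _ _) (le_max_right _ _)) hβ
  have hβ1 : 1 ≤ β := le_trans (le_trans (le_max_left _ _) (le_max_left _ _)) hβa
  have hβpos : 0 < β := by linarith
  have hθpow : (32 : ℝ) ≤ β ^ θ :=
    le_rpow_of_root_le (by norm_num) hθ (le_trans (le_trans (le_max_right _ _) (le_max_left _ _)) hβa)
  have hdiff : 16 * M ≤ β ^ (θ - A) :=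
    le_rpow_of_root_le (by positivity) hθA (le_trans (le_trans (le_max_left _ _) (le_max_right _ _)) hβa)
  have hApow : L ≤ β ^ A :=
    le_rpow_of_root_le (by positivity) hA (le_trans (le_trans (le_max_right _ _) (le_max_right _ _)) hβa)
  have hA1 : 1 ≤ β ^ A := hL1.trans hApow
  have hsplit : β ^ θ = β ^ (θ - A) * β ^ A := by
    rw [← Real.rpow_add hβpos]; ring_nf
  set T : ℕ := ⌈β ^ A⌉₊
  set H : ℕ := ⌈β ^ θ⌉₊
  have hT_ge : β ^ A ≤ (T : ℝ) := Nat.le_ceil _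
  have hT_lt : (T : ℝ) < β ^ A + 1 := Nat.ceil_lt_add_one (by positivity)
  have hT_le : (T : ℝ) ≤ 2 * β ^ A := by linarith
  have hH_ge : β ^ θ ≤ (H : ℝ) := Nat.le_ceil _
  have hT1 : 1 ≤ T := by
    have : (1 : ℝ) ≤ T := hA1.trans hT_ge
    exact_mod_cast this
  have hT0 : (0 : ℝ) < T := by exact_mod_cast hT1
  have hH32 : (32 : ℝ) ≤ H := hθpow.trans hH_ge
  have hTH_nat : T ≤ H := Nat.ceil_mono (Real.rpow_le_rpow_of_exponent_le hβ1 hAθ.le)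
  have hHT : M * (T : ℝ) ≤ (H : ℝ) / 8 := by
    have h1 : M * (T : ℝ) ≤ M * (2 * β ^ A) := mul_le_mul_of_nonneg_left hT_le (by linarith)
    have h2 : 16 * M * β ^ A ≤ β ^ (θ - A) * β ^ A := mul_le_mul_of_nonneg_right hdiff (by linarith)
    rw [← hsplit] at h2
    linarith
  have hTH : (T : ℝ) ≤ (H : ℝ) / 8 := by
    have : (T : ℝ) ≤ M * T := le_mul_of_one_le_left hT0.le hM1
    linarith
  -- the curvature number and its lower bound
  set C := @Literature.MathematicalPhysics.QuantumFieldTheory.curvaturePlaquetteCorr 4 (by norm_num) (T : ℤ)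
  have hasy := hC T hT1
  have hCT : K_C / (T : ℝ) ^ 5 ≤ (1 / π ^ 2 / (T : ℝ) ^ 4) / 2 := by
    have hLT : L ≤ (T : ℝ) := hApow.trans hT_ge
    have hKT : 2 * π ^ 2 * K_C ≤ (T : ℝ) := by linarith
    have e : (1 / π ^ 2 / (T : ℝ) ^ 4) / 2 = 1 / (2 * π ^ 2) / (T : ℝ) ^ 4 := by field_simp
    rw [e, div_le_div_iff₀ (by positivity) (by positivity)]
    calc K_C * (T : ℝ) ^ 4 = (2 * π ^ 2 * K_C) * (T : ℝ) ^ 4 * (1 / (2 * π ^ 2)) := by field_simp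
      _ ≤ (T : ℝ) * (T : ℝ) ^ 4 * (1 / (2 * π ^ 2)) := by gcongr
      _ = 1 / (2 * π ^ 2) * (T : ℝ) ^ 5 := by ring
  have hClow : (1 / π ^ 2 / (T : ℝ) ^ 4) / 2 ≤ C := by
    rw [abs_le] at hasy; linarith [hasy.1]
  have hC0 : 0 ≤ C := le_trans (by positivity) hClow
  -- the two kernel errors are `≤ C/(40(D+1))`
  have herrK : ∀ {K : ℝ}, 0 ≤ K → K ≤ K₁ + K₂ → K / (H : ℝ) ^ 4 ≤ C / (40 * (D + 1)) := by
    intro K hK0 hKle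
    have hMT : M * (T : ℝ) ≤ H := by linarith
    have hMT4 : (M * (T : ℝ)) ^ 4 ≤ (H : ℝ) ^ 4 := pow_le_pow_left₀ (by positivity) hMT 4
    have hM4 : 80 * π ^ 2 * (D + 1) * K ≤ M ^ 4 := by
      have h3 : M ≤ M ^ 4 := by
        calc M = M ^ 1 := (pow_one M).symm
          _ ≤ M ^ 4 := pow_le_pow_right₀ hM1 (by norm_num)
      have h4 : 80 * π ^ 2 * (D + 1) * K ≤ 80 * π ^ 2 * (D + 1) * (K₁ + K₂) :=
        mul_le_mul_of_nonneg_left hKle (by positivity)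
      have h5 : 80 * π ^ 2 * (D + 1) * (K₁ + K₂) = M - 1 := by rw [hM]; ring
      linarith
    have hstep : K / (H : ℝ) ^ 4 ≤ 1 / (80 * π ^ 2 * (D + 1)) / (T : ℝ) ^ 4 := by
      rw [div_le_div_iff₀ (by positivity) (by positivity)]
      calc K * (T : ℝ) ^ 4 = (80 * π ^ 2 * (D + 1) * K) * (T : ℝ) ^ 4 * (1 / (80 * π ^ 2 * (D + 1))) := by
            field_simp
        _ ≤ M ^ 4 * (T : ℝ) ^ 4 * (1 / (80 * π ^ 2 * (D + 1))) := by gcongr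
        _ = 1 / (80 * π ^ 2 * (D + 1)) * (M * (T : ℝ)) ^ 4 := by ring
        _ ≤ 1 / (80 * π ^ 2 * (D + 1)) * (H : ℝ) ^ 4 := mul_le_mul_of_nonneg_left hMT4 (by positivity)
    have e : 1 / (80 * π ^ 2 * (D + 1)) / (T : ℝ) ^ 4 = ((1 / π ^ 2 / (T : ℝ) ^ 4) / 2) / (40 * (D + 1)) := by
      field_simp; ring
    rw [e] at hstep
    exact hstep.trans (div_le_div_of_nonneg_right hClow (by positivity))
  have h1 : |boxMaxwellPlaqCov H T - C| ≤ C / (40 * (D + 1)) := (hE1 H hH32 T hTH).trans (herrK hK10 (by linarith))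
  have h2 : |boxDirichletPlaqCov H T - C| ≤ C / (40 * (D + 1)) := (hE2 H hH32 T hTH).trans (herrK hK20 (by linarith))
  -- the absolute error is `≤ C²/20`
  have hC2 : 1 / (4 * π ^ 4) / (2 * β ^ A) ^ (8 : ℕ) ≤ C ^ 2 := by
    have hsq := pow_le_pow_left₀ (by positivity) hClow 2
    have hT8 : (T : ℝ) ^ 8 ≤ (2 * β ^ A) ^ (8 : ℕ) := pow_le_pow_left₀ hT0.le hT_le 8
    calc 1 / (4 * π ^ 4) / (2 * β ^ A) ^ (8 : ℕ) ≤ 1 / (4 * π ^ 4) / (T : ℝ) ^ 8 :=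
          div_le_div_of_nonneg_left (by positivity) (by positivity) hT8
      _ = ((1 / π ^ 2 / (T : ℝ) ^ 4) / 2) ^ 2 := by field_simp; ring
      _ ≤ C ^ 2 := hsq
  have hsmall : β ^ (-κ) ≤ C ^ 2 / 20 := by
    have e4 := h₄ β hb₄
    have hden : (0 : ℝ) < (2 * β ^ A) ^ (8 : ℕ) := by positivity
    have h3 : β ^ (-κ) ≤ 1 / (4 * π ^ 4) / 20 / (2 * β ^ A) ^ (8 : ℕ) := by
      rw [le_div_iff₀ hden]; exact e4
    calc β ^ (-κ) ≤ 1 / (4 * π ^ 4) / 20 / (2 * β ^ A) ^ (8 : ℕ) := h3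
      _ = (1 / (4 * π ^ 4) / (2 * β ^ A) ^ (8 : ℕ)) / 20 := by ring
      _ ≤ C ^ 2 / 20 := by linarith [hC2]
  have habsT := (h₁ β hb₁ T hTH_nat).trans hsmall
  -- Wick on both sides and the scalar endgame
  rw [stub_boxGaussianWick]
  set e : ℝ := F β H T - D / 4 * boxDirCircSqCov H T with he
  have hcov : F β H T = D / 4 * (2 * boxDirichletPlaqCov H T ^ 2) + e := by
    rw [he, boxDirCircSqCov_eq_two_mul_sq]; ring
  rw [hcov]
  exact scalar_relative_of_abs_dim hD hC0 h1 h2 habsT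

/-- **Stub S3 `stub_boxGaussianDominationG_of_abs` of crux `BoxFloorAllGroups` (registered signature, verbatim): the absolute
Dirichlet comparison implies the relative free form, for every compact simple `G`.**  From the `G`-universal absolute statement
(the conclusion of S2 `stub_boxDirichletDominationAbsG`): for every compact simple `G` and lattice representation `r` there is
`θ₀ > 0` such that for all `0 < A < θ ≤ θ₀`, eventually in `β`,
`|β²·boxPlaqCov r.ρ β ⌈β^θ⌉ ⌈β^A⌉ − (D/4)·boxCircSqCov ⌈β^θ⌉ ⌈β^A⌉| ≤ (1/8)·boxCircSqCov ⌈β^θ⌉ ⌈β^A⌉`, `D = dimE r.ρ`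
(instantiate the hypothesis at `(G, r)` and apply `gaussianDomination_of_abs_dim` with `F β H T = β²·boxPlaqCov r.ρ β H T`). -/
theorem stub_boxGaussianDominationG_of_abs :
    (∀ (G : Type) [Group G] [TopologicalSpace G] [IsTopologicalGroup G] [CompactSpace G],
      IsCompactSimpleLieGroup G →
      letI : MeasurableSpace G := borel G
      haveI : BorelSpace G := ⟨rfl⟩
      ∀ r : LatticeRep G, ∃ θ₀ : ℝ, 0 < θ₀ ∧ ∀ θ : ℝ, 0 < θ → θ ≤ θ₀ → ∃ κ : ℝ, 8 * θ < κ ∧ ∃ β₀ : ℝ, ∀ β : ℝ, β₀ ≤ β →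
        ∀ T : ℕ, T ≤ ⌈β ^ θ⌉₊ →
          |β ^ 2 * boxPlaqCov r.ρ β ⌈β ^ θ⌉₊ T - (dimE r.ρ : ℝ) / 4 * boxDirCircSqCov ⌈β ^ θ⌉₊ T| ≤ β ^ (-κ)) →
    ∀ (G : Type) [Group G] [TopologicalSpace G] [IsTopologicalGroup G] [CompactSpace G],
    IsCompactSimpleLieGroup G →
    letI : MeasurableSpace G := borel G
    haveI : BorelSpace G := ⟨rfl⟩
    ∀ r : LatticeRep G, ∃ θ₀ : ℝ, 0 < θ₀ ∧ ∀ A θ : ℝ, 0 < A → A < θ → θ ≤ θ₀ → ∃ β₀ : ℝ, ∀ β : ℝ, β₀ ≤ β →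
      |β ^ 2 * boxPlaqCov r.ρ β ⌈β ^ θ⌉₊ ⌈β ^ A⌉₊ - (dimE r.ρ : ℝ) / 4 * boxCircSqCov ⌈β ^ θ⌉₊ ⌈β ^ A⌉₊| ≤
        1 / 8 * boxCircSqCov ⌈β ^ θ⌉₊ ⌈β ^ A⌉₊ := by
  intro habs G _ _ _ _ hG
  letI : MeasurableSpace G := borel G
  haveI : BorelSpace G := ⟨rfl⟩
  intro r
  exact gaussianDomination_of_abs_dim (D := (dimE r.ρ : ℝ)) (fun β H T => β ^ 2 * boxPlaqCov r.ρ β H T)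
    (Nat.cast_nonneg _) (habs G hG r)

end Summit.QuantumFields.YangMills.Theorems.ColdBoxAllGroups
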